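import Summits.Ventures.PercRepro.S1SevenSixThreeFour

/-!
# PercRepro — THE GENERAL RANK-2 `m`-SET INCIDENCE COUNT (p2, gen 28; SUBCLAIM-S1 §6.10 (xvii)(o))

If every pair of a matroid with all pairs of rank `2` has a closure of at most `c + 2` points, then the rank-`2`
sets of size `m` number at most `C(c, m − 2) · C(|E|, 2) / C(m, 2)`: each such set contains `C(m, 2)` pairs, and
each pair `P` lies in at most `C(c, m − 2)` of them (they are the sets `P ∪ S` with `S` an `(m − 2)`-subset of the
at most `c` further points of the closure of `P`). The triple count of `S1EightFiveFiveThree` is the case `m = 3`.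
Nothing is claimed about any cell.

* `rankTwoSets`, `rankTwoSetPairs`; **`choose_mul_ncard_rankTwoSets_le`**.
Axioms: standard.
-/

open scoped Matroid

namespace PercRepro

namespace S1

open Set

variable {α : Type}

/-- The rank-`2` sets of size `m`. -/
def rankTwoSets (M : Matroid α) (m : ℕ) : Set (Set α) :=
  {X : Set α | X ⊆ M.E ∧ X.ncard = m ∧ M.eRk X = 2}

/-- The incidences «a rank-`2` `m`-set with one of its pairs». -/
def rankTwoSetPairs (M : Matroid α) (m : ℕ) : Set (Set α × Set α) :=
  {Q : Set α × Set α | Q.1 ∈ rankTwoSets M m ∧ Q.2 ⊆ Q.1 ∧ Q.2.ncard = 2}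

/-- The rank-`2` `m`-sets are finite. -/
theorem rankTwoSets_finite (M : Matroid α) [M.Finite] (m : ℕ) : (rankTwoSets M m).Finite :=
  M.ground_finite.finite_subsets.subset (fun _ hX => hX.1)

/-- **THE GENERAL INCIDENCE COUNT**: `C(m, 2) · #(rank-2 m-sets) ≤ C(c, m − 2) · C(|E|, 2)` when the closure of
every pair has at most `c + 2` points. -/
theorem choose_mul_ncard_rankTwoSets_le (M : Matroid α) [M.Finite]
    (hpairs : ∀ e ∈ M.E, ∀ f ∈ M.E, e ≠ f → M.eRk {e, f} = 2) {c m : ℕ}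
    (hcl : ∀ x ∈ M.E, ∀ y ∈ M.E, x ≠ y → (M.closure {x, y}).ncard ≤ c + 2) :
    Nat.choose m 2 * (rankTwoSets M m).ncard ≤ Nat.choose c (m - 2) * Nat.choose M.E.ncard 2 := by
  have hTfin := rankTwoSets_finite M m
  have hQfin : (rankTwoSetPairs M m).Finite :=
    (M.ground_finite.finite_subsets.prod M.ground_finite.finite_subsets).subset
      (fun Q hQ => ⟨hQ.1.1, hQ.2.1.trans hQ.1.1⟩)
  -- lower side: `C(m, 2)` pairs per set
  have heq : rankTwoSetPairs M m = ⋃ X ∈ rankTwoSets M m,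
      ({X} ×ˢ {P : Set α | P ⊆ X ∧ P.ncard = 2} : Set (Set α × Set α)) := by
    ext ⟨X, P⟩
    simp only [rankTwoSetPairs, mem_setOf_eq, mem_iUnion, mem_prod, mem_singleton_iff, exists_prop]
    constructor
    · rintro ⟨hX, hPX, hP2⟩
      exact ⟨X, hX, rfl, hPX, hP2⟩
    · rintro ⟨X', hX', rfl, hPX, hP2⟩
      exact ⟨hX', hPX, hP2⟩
  have hfib : ∀ X ∈ rankTwoSets M m, (({X} ×ˢ {P : Set α | P ⊆ X ∧ P.ncard = 2} : Set (Set α × Set α))).Finite :=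
    fun X hX => (finite_singleton X).prod ((M.ground_finite.subset hX.1).finite_subsets.subset (fun _ hP => hP.1))
  have hdisj : (rankTwoSets M m).PairwiseDisjoint
      (fun X : Set α => ({X} ×ˢ {P : Set α | P ⊆ X ∧ P.ncard = 2} : Set (Set α × Set α))) := by
    intro X _ X' _ hXX
    rw [Function.onFun, Set.disjoint_left]
    rintro ⟨C, P⟩ ⟨hC1, -⟩ ⟨hC2, -⟩
    apply hXX
    rw [mem_singleton_iff] at hC1 hC2
    rw [← hC1, ← hC2]
  have hlow : Nat.choose m 2 * (rankTwoSets M m).ncard = (rankTwoSetPairs M m).ncard := by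
    rw [heq, hTfin.ncard_biUnion hfib hdisj, finsum_mem_eq_finite_toFinset_sum _ hTfin]
    rw [Finset.sum_congr rfl (g := fun _ => Nat.choose m 2) ?_]
    · rw [Finset.sum_const, smul_eq_mul, ncard_eq_toFinset_card _ hTfin, mul_comm]
    · intro X hX
      rw [Finite.mem_toFinset] at hX
      rw [ncard_prod, ncard_singleton, one_mul, ncard_setOf_subset_ncard_eq (M.ground_finite.subset hX.1) 2,
        hX.2.1]
  -- upper side: over each pair at most `C(c, m − 2)` sets
  have hPfin : {P : Set α | P ⊆ M.E ∧ P.ncard = 2}.Finite :=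
    M.ground_finite.finite_subsets.subset (fun _ hP => hP.1)
  have hup : rankTwoSetPairs M m ⊆ ⋃ P ∈ {P : Set α | P ⊆ M.E ∧ P.ncard = 2},
      {Q ∈ rankTwoSetPairs M m | Q.2 = P} := by
    rintro ⟨X, P⟩ ⟨hX, hPX, hP2⟩
    rw [mem_iUnion₂]
    exact ⟨P, ⟨hPX.trans hX.1, hP2⟩, ⟨hX, hPX, hP2⟩, rfl⟩
  have hfibP : ∀ P ∈ {P : Set α | P ⊆ M.E ∧ P.ncard = 2},
      {Q ∈ rankTwoSetPairs M m | Q.2 = P}.ncard ≤ Nat.choose c (m - 2) := by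
    rintro P ⟨hPE, hP2⟩
    obtain ⟨x, y, hxy, rfl⟩ := ncard_eq_two.mp hP2
    have hx : x ∈ M.E := hPE (by simp)
    have hy : y ∈ M.E := hPE (by simp)
    have hclxy := hcl x hx y hy hxy
    have hclE : M.closure {x, y} ⊆ M.E := M.closure_subset_ground _
    have hsubcl : ({x, y} : Set α) ⊆ M.closure {x, y} := M.subset_closure _ hPE
    have hrestfin : (M.closure {x, y} \ {x, y}).Finite := (M.ground_finite.subset hclE).subset sdiff_subset
    have hrest : (M.closure {x, y} \ {x, y}).ncard ≤ c := by
      rw [ncard_sdiff' hsubcl (M.ground_finite.subset hclE), hP2]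
      omega
    -- the fibre injects into the `(m − 2)`-subsets of `cl {x, y} ∖ {x, y}` via `X ↦ X ∖ {x, y}`
    have hsub : {Q ∈ rankTwoSetPairs M m | Q.2 = {x, y}} ⊆
        (fun S => ({x, y} ∪ S, ({x, y} : Set α))) ''
          {S : Set α | S ⊆ M.closure {x, y} \ {x, y} ∧ S.ncard = m - 2} := by
      rintro ⟨X, P⟩ ⟨⟨⟨hXE, hXm, hX2⟩, hPX, -⟩, hPxy⟩
      have hPxy' : P = {x, y} := hPxy
      subst hPxy'
      have hXfin : X.Finite := M.ground_finite.subset hXE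
      have hXcl : X ⊆ M.closure {x, y} := by
        intro z hz
        rw [mem_closure_iff_eRk_insert_eq M (hXE hz) hPE]
        have hle : M.eRk (insert z {x, y}) ≤ M.eRk X := M.eRk_mono (insert_subset hz hPX)
        have hge : M.eRk {x, y} ≤ M.eRk (insert z {x, y}) := M.eRk_mono (subset_insert _ _)
        rw [hX2] at hle
        rw [hpairs x hx y hy hxy] at hge ⊢
        exact le_antisymm hle hge
      refine ⟨X \ {x, y}, ⟨fun z hz => ⟨hXcl hz.1, hz.2⟩, ?_⟩, ?_⟩
      · rw [ncard_sdiff' hPX hXfin, hXm, hP2]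
      · simp only [Prod.mk.injEq, and_true]
        exact (union_sdiff_cancel hPX).symm ▸ rfl
    have hcount : {S : Set α | S ⊆ M.closure {x, y} \ {x, y} ∧ S.ncard = m - 2}.ncard ≤ Nat.choose c (m - 2) := by
      rw [ncard_setOf_subset_ncard_eq hrestfin (m - 2)]
      exact Nat.choose_le_choose _ hrest
    exact (ncard_le_ncard hsub ((hrestfin.finite_subsets.subset (fun _ hS => hS.1)).image _)).trans
      ((ncard_image_le (hrestfin.finite_subsets.subset (fun _ hS => hS.1))).trans hcount)
  have hcardP : {P : Set α | P ⊆ M.E ∧ P.ncard = 2}.ncard = Nat.choose M.E.ncard 2 :=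
    ncard_setOf_subset_ncard_eq M.ground_finite 2
  calc Nat.choose m 2 * (rankTwoSets M m).ncard = (rankTwoSetPairs M m).ncard := hlow
    _ ≤ (⋃ P ∈ {P : Set α | P ⊆ M.E ∧ P.ncard = 2}, {Q ∈ rankTwoSetPairs M m | Q.2 = P}).ncard :=
        ncard_le_ncard hup (hPfin.biUnion (fun P _ => hQfin.subset (fun Q hQ => hQ.1)))
    _ ≤ ∑ᶠ P ∈ {P : Set α | P ⊆ M.E ∧ P.ncard = 2}, {Q ∈ rankTwoSetPairs M m | Q.2 = P}.ncard :=
        hPfin.ncard_biUnion_le _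
    _ = ∑ P ∈ hPfin.toFinset, {Q ∈ rankTwoSetPairs M m | Q.2 = P}.ncard := finsum_mem_eq_finite_toFinset_sum _ hPfin
    _ ≤ hPfin.toFinset.card • Nat.choose c (m - 2) := by
        apply Finset.sum_le_card_nsmul
        intro P hP
        rw [Finite.mem_toFinset] at hP
        exact hfibP P hP
    _ = Nat.choose c (m - 2) * Nat.choose M.E.ncard 2 := by
        rw [smul_eq_mul, ← ncard_eq_toFinset_card _ hPfin, hcardP, mul_comm]

end S1

end PercRepro
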